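import Summits.BirchSwinnertonDyer.BirchSwinnertonDyer.Theorems.ByReductionTypeAtTwoFineSelmerConjAAtTwoAdditivePotGoodClassNumberOne9980
import Summits.BirchSwinnertonDyer.BirchSwinnertonDyer.Theorems.ByReductionTypeAtTwoFineSelmerConjAAtTwoAdditivePotGoodClassNumberOned12936n
import Summits.BirchSwinnertonDyer.BirchSwinnertonDyer.Theorems.ByReductionTypeAtTwoFineSelmerConjAAtTwoAdditivePotGoodClassNumberOned11988n
import Summits.BirchSwinnertonDyer.BirchSwinnertonDyer.Theorems.ByReductionTypeAtTwoFineSelmerConjAAtTwoAdditivePotGoodChevalleyOneBitDoor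
import HarnessLib

/-!
# Census rows with NO displayed bit: the one-bit rows closed by Chevalley's door at `p = 2`

Sub-problem `BirchSwinnertonDyer`, route `ByReductionTypeAtTwo`, item `FineSelmerConjAAtTwoAdditivePotGood` (C1″), helper file
(census currency).  Rows: `279440c1`, `413952bm1`, `227772e1`.  Each former one-bit stamp `conjA_two_<L>_of_layerOneBit hLim2 hθ h1`
displayed `h1 : ∀ κL cyclotomic over ℚ(θ), e₁(κL) = 0` (`2 ∤ h(ℚ(θ, √2))`); here `h1` is DISCHARGED by
`layerOneBit_of_chevalleyCert` (file `…ChevalleyOneBitDoor`): Chevalley's ambiguous class number formula for `ℚ(θ,√2)/ℚ(θ)`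
with a unit of `ℚ(θ)` whose `2`-adic image is `≡ ±3 (mod 8)` (not a norm), `2 ∤ h(ℚ(θ))` (kernel certificate already in the
tree) and at most two primes above `2` (two `4 ∤ g` witnesses).  Result: `conjA_two_<L> hLim2 hθ κ hκ` — the row is conditional on
`hLim2` ALONE, like the Fukuda / unique-prime rows.

## What this does NOT prove
`hLim2` (Lim 2017, Thm. 3.5 at `p = 2`) remains an input in print; Conjecture A itself and BSD are not advanced by these stamps.
-/

set_option autoImplicit false
set_option linter.dupNamespace false

noncomputable section

open scoped Classical IntermediateField NumberField Real nonZeroDivisors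

namespace Summit.BirchSwinnertonDyer.BirchSwinnertonDyer.Theorems.AddKatoTwo

open WeierstrassCurve Field Polynomial IsDedekindDomain NumberField Matrix Literature.NumberTheory.EllipticCurves
  Literature.NumberTheory.IwasawaTheory

/-- **Row `279440c1` — NO displayed bit left (`hLim2` ALONE).**  `K = ℚ(θ)`, `θ³ − 1θ² − 36θ − 70 = 0`:
the former displayed bit `e₁ = 0` (`2 ∤ h(K(√2))`) is DECIDED by Chevalley's door at `p = 2` with the certificate
unit `ε = (449 + 91θ + -21θ²)/1` (`ε³ + (95)ε² + (-8327)ε + (-1) = 0`), Hensel datum `a = 3` (`8 ∣ g(3)`, `g'(3)` odd) and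
`ε ≡ 5 (mod 8)` under `θ ↦ z ≡ 3`: `(ε, 2)₂ = −1`; at most two primes above `2` by `4 ∤ g(0)`, `4 ∤ g(1)`.
Remaining input: `hLim2` (Lim's Theorem 3.5 at `p = 2`, in print).  BSD is not advanced by this stamp. -/
theorem conjA_two_279440c1
    (hLim2 : Lim2017.thm35_at_two_fineSelmerDual_moduleFinite_of_classicalMuVanishes_of_le_divisionField_four)
    {θ : AlgebraicClosure ℚ} (hθ : aeval θ (Cubic.toPoly ⟨1, ((-1 : ℤ) : ℚ), ((-36 : ℤ) : ℚ), ((-70 : ℤ) : ℚ)⟩) = 0)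
    (κ : ZpExtension ℚ 2) (hκ : κ.IsCyclotomic) :
    haveI := isElliptic_279440c1'
    ∃ (γ : absoluteGaloisGroup ℚ) (D : (⟨0, ((1 : ℤ) : ℚ), 0, ((-114041197436 : ℤ) : ℚ), ((-14823196533966296 : ℤ) : ℚ)⟩ : WeierstrassCurve ℚ).FineSelmerDualData κ γ),
      Module.Finite ℤ_[2] (RestrictScalars ℤ_[2] (IwasawaAlgebra 2) D.X) := by
  haveI := isElliptic_279440c1'
  have hθ' : θ ^ 3 + (-1 : AlgebraicClosure ℚ) * θ ^ 2 + (-36 : AlgebraicClosure ℚ) * θ + (-70 : AlgebraicClosure ℚ) = 0 := by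
    have := hθ
    simp only [Cubic.toPoly, map_one, one_mul, aeval_add, aeval_mul, aeval_C, aeval_X_pow, aeval_X,
      eq_ratCast, Rat.cast_intCast] at this
    push_cast at this
    linear_combination this
  have he : aeval (algebraMap ℚ (AlgebraicClosure ℚ) (((449 : ℤ) : ℚ) / ((1 : ℤ) : ℚ)) +
      algebraMap ℚ (AlgebraicClosure ℚ) (((91 : ℤ) : ℚ) / ((1 : ℤ) : ℚ)) * θ +
      algebraMap ℚ (AlgebraicClosure ℚ) (((-21 : ℤ) : ℚ) / ((1 : ℤ) : ℚ)) * θ ^ 2)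
      (Cubic.toPoly ⟨1, ((95 : ℤ) : ℚ), ((-8327 : ℤ) : ℚ), ((-1 : ℤ) : ℚ)⟩) = 0 := by
    simp only [Cubic.toPoly, map_one, one_mul, aeval_add, aeval_mul, aeval_C, aeval_X_pow, aeval_X, eq_ratCast,
      Rat.cast_intCast, Rat.cast_div]
    push_cast
    linear_combination ((-1513316 : AlgebraicClosure ℚ) + (-108045 : AlgebraicClosure ℚ) * θ + (111132 : AlgebraicClosure ℚ) * θ ^ 2 + (-9261 : AlgebraicClosure ℚ) * θ ^ 3) * hθ'
  exact conjA_two_279440c1_of_layerOneBit hLim2 hθ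
    (layerOneBit_of_chevalleyCert irreducible_cubic_d9980p hθ (not_two_dvd_card_classGroup_adjoin_of_forall_cubicField irreducible_cubic_d9980p (classNumber_eq_one_of_root_d9980) hθ) ⟨0, by norm_num⟩ ⟨0, by norm_num⟩
      (449) (91) (-21) (1) (95) (-8327) (-1) (by norm_num) he (3) (1) (by norm_num) (by norm_num) (by decide) (by decide)) κ hκ

/-- **Row `413952bm1` — NO displayed bit left (`hLim2` ALONE).**  `K = ℚ(θ)`, `θ³ − 1θ² − 30θ + 78 = 0`:
the former displayed bit `e₁ = 0` (`2 ∤ h(K(√2))`) is DECIDED by Chevalley's door at `p = 2` with the certificate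
unit `ε = (-9985 + 1041θ + 443θ²)/1` (`ε³ + (1891)ε² + (7468361)ε + (-1) = 0`), Hensel datum `a = 1` (`8 ∣ g(1)`, `g'(1)` odd) and
`ε ≡ 3 (mod 8)` under `θ ↦ z ≡ 1`: `(ε, 2)₂ = −1`; at most two primes above `2` by `4 ∤ g(0)`, `4 ∤ g(3)`.
Remaining input: `hLim2` (Lim's Theorem 3.5 at `p = 2`, in print).  BSD is not advanced by this stamp. -/
theorem conjA_two_413952bm1
    (hLim2 : Lim2017.thm35_at_two_fineSelmerDual_moduleFinite_of_classicalMuVanishes_of_le_divisionField_four)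
    {θ : AlgebraicClosure ℚ} (hθ : aeval θ (Cubic.toPoly ⟨1, ((-1 : ℤ) : ℚ), ((-30 : ℤ) : ℚ), ((78 : ℤ) : ℚ)⟩) = 0)
    (κ : ZpExtension ℚ 2) (hκ : κ.IsCyclotomic) :
    haveI := isElliptic_413952bm1'
    ∃ (γ : absoluteGaloisGroup ℚ) (D : (⟨0, ((-1 : ℤ) : ℚ), 0, ((-134300735 : ℤ) : ℚ), ((-599008857117 : ℤ) : ℚ)⟩ : WeierstrassCurve ℚ).FineSelmerDualData κ γ),
      Module.Finite ℤ_[2] (RestrictScalars ℤ_[2] (IwasawaAlgebra 2) D.X) := by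
  haveI := isElliptic_413952bm1'
  have hθ' : θ ^ 3 + (-1 : AlgebraicClosure ℚ) * θ ^ 2 + (-30 : AlgebraicClosure ℚ) * θ + (78 : AlgebraicClosure ℚ) = 0 := by
    have := hθ
    simp only [Cubic.toPoly, map_one, one_mul, aeval_add, aeval_mul, aeval_C, aeval_X_pow, aeval_X,
      eq_ratCast, Rat.cast_intCast] at this
    push_cast at this
    linear_combination this
  have he : aeval (algebraMap ℚ (AlgebraicClosure ℚ) (((-9985 : ℤ) : ℚ) / ((1 : ℤ) : ℚ)) +
      algebraMap ℚ (AlgebraicClosure ℚ) (((1041 : ℤ) : ℚ) / ((1 : ℤ) : ℚ)) * θ +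
      algebraMap ℚ (AlgebraicClosure ℚ) (((443 : ℤ) : ℚ) / ((1 : ℤ) : ℚ)) * θ ^ 2)
      (Cubic.toPoly ⟨1, ((1891 : ℤ) : ℚ), ((7468361 : ℤ) : ℚ), ((-1 : ℤ) : ℚ)⟩) = 0 := by
    simp only [Cubic.toPoly, map_one, one_mul, aeval_add, aeval_mul, aeval_C, aeval_X_pow, aeval_X, eq_ratCast,
      Rat.cast_intCast, Rat.cast_div]
    push_cast
    linear_combination ((-11301861612 : AlgebraicClosure ℚ) + (-759346743 : AlgebraicClosure ℚ) * θ + (699823934 : AlgebraicClosure ℚ) * θ ^ 2 + (86938307 : AlgebraicClosure ℚ) * θ ^ 3) * hθ'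
  exact conjA_two_413952bm1_of_layerOneBit hLim2 hθ
    (layerOneBit_of_chevalleyCert irreducible_cubic_d12936n hθ (not_two_dvd_card_classGroup_adjoin_of_forall_cubicField_odd irreducible_cubic_d12936n (odd_classNumber_of_root_d12936n) hθ) ⟨0, by norm_num⟩ ⟨1, by norm_num⟩
      (-9985) (1041) (443) (1) (1891) (7468361) (-1) (by norm_num) he (1) (1) (by norm_num) (by norm_num) (by decide) (by decide)) κ hκ

/-- **Row `227772e1` — NO displayed bit left (`hLim2` ALONE).**  `K = ℚ(θ)`, `θ³ + 0θ² + 33θ − 76 = 0`: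
the former displayed bit `e₁ = 0` (`2 ∤ h(K(√2))`) is DECIDED by Chevalley's door at `p = 2` with the certificate
unit `ε = (5556677 + -6903122θ + 2047192θ²)/1` (`ε³ + (118444641)ε² + (7949698203601839)ε + (-1) = 0`), Hensel datum `a = 4` (`8 ∣ g(4)`, `g'(4)` odd) and
`ε ≡ 5 (mod 8)` under `θ ↦ z ≡ 4`: `(ε, 2)₂ = −1`; at most two primes above `2` by `4 ∤ g(2)`, `4 ∤ g(1)`.
Remaining input: `hLim2` (Lim's Theorem 3.5 at `p = 2`, in print).  BSD is not advanced by this stamp. -/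
theorem conjA_two_227772e1
    (hLim2 : Lim2017.thm35_at_two_fineSelmerDual_moduleFinite_of_classicalMuVanishes_of_le_divisionField_four)
    {θ : AlgebraicClosure ℚ} (hθ : aeval θ (Cubic.toPoly ⟨1, ((0 : ℤ) : ℚ), ((33 : ℤ) : ℚ), ((-76 : ℤ) : ℚ)⟩) = 0)
    (κ : ZpExtension ℚ 2) (hκ : κ.IsCyclotomic) :
    haveI := isElliptic_227772e1'
    ∃ (γ : absoluteGaloisGroup ℚ) (D : (⟨0, ((0 : ℤ) : ℚ), 0, ((-1754845767 : ℤ) : ℚ), ((-28294794379890 : ℤ) : ℚ)⟩ : WeierstrassCurve ℚ).FineSelmerDualData κ γ),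
      Module.Finite ℤ_[2] (RestrictScalars ℤ_[2] (IwasawaAlgebra 2) D.X) := by
  haveI := isElliptic_227772e1'
  have hθ' : θ ^ 3 + (0 : AlgebraicClosure ℚ) * θ ^ 2 + (33 : AlgebraicClosure ℚ) * θ + (-76 : AlgebraicClosure ℚ) = 0 := by
    have := hθ
    simp only [Cubic.toPoly, map_one, one_mul, aeval_add, aeval_mul, aeval_C, aeval_X_pow, aeval_X,
      eq_ratCast, Rat.cast_intCast] at this
    push_cast at this
    linear_combination this
  set θ₁ : AlgebraicClosure ℚ := algebraMap ℚ (AlgebraicClosure ℚ) (22 / 5 : ℚ) +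
      algebraMap ℚ (AlgebraicClosure ℚ) (3 / 5 : ℚ) * θ + algebraMap ℚ (AlgebraicClosure ℚ) (1 / 5 : ℚ) * θ ^ 2 with hθ₁def
  have hθ₁ : aeval θ₁ (Cubic.toPoly ⟨1, ((0 : ℤ) : ℚ), ((-30 : ℤ) : ℚ), ((-76 : ℤ) : ℚ)⟩) = 0 := by
    simp only [Cubic.toPoly, map_one, one_mul, aeval_add, aeval_mul, aeval_C, aeval_X_pow, aeval_X, eq_ratCast,
      Rat.cast_intCast]
    rw [hθ₁def]
    simp only [eq_ratCast]
    push_cast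
    linear_combination (((202 : AlgebraicClosure ℚ) / 125) + ((12 : AlgebraicClosure ℚ) / 25) * θ + ((9 : AlgebraicClosure ℚ) / 125) * θ ^ 2 + ((1 : AlgebraicClosure ℚ) / 125) * θ ^ 3) * hθ'
  have hadj : IntermediateField.adjoin ℚ {θ₁} = IntermediateField.adjoin ℚ {θ} := by
    apply le_antisymm
    · rw [IntermediateField.adjoin_simple_le_iff, hθ₁def]
      have hθmem := IntermediateField.mem_adjoin_simple_self ℚ θ
      exact add_mem (add_mem (algebraMap_mem _ _) (mul_mem (algebraMap_mem _ _) hθmem))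
        (mul_mem (algebraMap_mem _ _) (pow_mem hθmem 2))
    · rw [IntermediateField.adjoin_simple_le_iff]
      have hθeq : θ = algebraMap ℚ (AlgebraicClosure ℚ) (10 : ℚ) + algebraMap ℚ (AlgebraicClosure ℚ) (2 : ℚ) * θ₁ +
          algebraMap ℚ (AlgebraicClosure ℚ) (-1 / 2 : ℚ) * θ₁ ^ 2 := by
        rw [hθ₁def]; simp only [eq_ratCast]; push_cast; linear_combination (((3 : AlgebraicClosure ℚ) / 25) + ((1 : AlgebraicClosure ℚ) / 50) * θ) * hθ'
      rw [hθeq]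
      have hθ₁mem := IntermediateField.mem_adjoin_simple_self ℚ θ₁
      exact add_mem (add_mem (algebraMap_mem _ _) (mul_mem (algebraMap_mem _ _) hθ₁mem))
        (mul_mem (algebraMap_mem _ _) (pow_mem hθ₁mem 2))
  have hh : ¬ 2 ∣ Nat.card (ClassGroup (𝓞 (IntermediateField.adjoin ℚ {θ}))) := by
    rw [← hadj]
    exact not_two_dvd_card_classGroup_adjoin_of_forall_cubicField irreducible_cubic_d11988n_min (classNumber_eq_one_of_root_d11988n) hθ₁
  have he : aeval (algebraMap ℚ (AlgebraicClosure ℚ) (((5556677 : ℤ) : ℚ) / ((1 : ℤ) : ℚ)) +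
      algebraMap ℚ (AlgebraicClosure ℚ) (((-6903122 : ℤ) : ℚ) / ((1 : ℤ) : ℚ)) * θ +
      algebraMap ℚ (AlgebraicClosure ℚ) (((2047192 : ℤ) : ℚ) / ((1 : ℤ) : ℚ)) * θ ^ 2)
      (Cubic.toPoly ⟨1, ((118444641 : ℤ) : ℚ), ((7949698203601839 : ℤ) : ℚ), ((-1 : ℤ) : ℚ)⟩) = 0 := by
    simp only [Cubic.toPoly, map_one, one_mul, aeval_add, aeval_mul, aeval_C, aeval_X_pow, aeval_X, eq_ratCast,
      Rat.cast_intCast, Rat.cast_div]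
    push_cast
    linear_combination ((-631613836991334026824 : AlgebraicClosure ℚ) + (575797557547488211488 : AlgebraicClosure ℚ) * θ + (-86792851116649636224 : AlgebraicClosure ℚ) * θ ^ 2 + (8579771609772901888 : AlgebraicClosure ℚ) * θ ^ 3) * hθ'
  exact conjA_two_227772e1_of_layerOneBit hLim2 hθ
    (layerOneBit_of_chevalleyCert irreducible_cubic_d11988n hθ hh ⟨1, by norm_num⟩ ⟨0, by norm_num⟩
      (5556677) (-6903122) (2047192) (1) (118444641) (7949698203601839) (-1) (by norm_num) he (4) (1) (by norm_num) (by norm_num) (by decide) (by decide)) κ hκ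

end Summit.BirchSwinnertonDyer.BirchSwinnertonDyer.Theorems.AddKatoTwo

end
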